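import Summits.QuantumFields.YangMills.Theorems.FluctuationComparisonRegPrIntLHaarTubeLocalCharge
import Summits.QuantumFields.YangMills.Theorems.FluctuationComparisonRegPrIntLHaarFloorDepthOne
import Summits.QuantumFields.YangMills.Theorems.FluctuationComparisonRegPrIntLSectionTubeSplit
import HarnessLib

/-!
# `FluctuationComparisonRegPrIntLHaarTubeNoMargin` — ⟨HAAR-TUBE₁⟩ WITHOUT MARGIN, UNCONDITIONALLY: TUBE∘'s literal K-free letter (the third conjunct of
# ✓`…SectionTubeSplit.sectionTubeMassIntCan_of_up_low_haarTube`) is a THEOREM, by reading the window charts at the DOUBLED profile `2b₀`; hence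
# TUBE∘ ⟸ ⟨UP⟩ + ⟨LOW(2θ)⟩ only (crux `FluctuationComparisonRegPrIntL`, stmt-QuantumFields-20520; LINE g22-4 row TUBE∘ `SectionTubeMassIntCan`)

Cell `ym3-torus` (YM ladder rung R3 = continuum SU(2) Yang–Mills on T³ — a RUNG, NOT d = 4, NOT infinite volume, NOT a mass gap, NOT Clay);
width seat `ym-ust-20520-w4` (gen 18), explicit-unit helper; `--supports stmt-QuantumFields-20520 --as helper`.  THEOREMS ONLY (0 `def`, 0 `sorry`,
default heartbeats).

WHAT.  LEAD w3-20520 g18's split ✓`sectionTubeMassIntCan_of_up_low_haarTube` asks, besides the K-UNIFORM letters ⟨UP⟩ ∕ ⟨LOW(2θ)⟩ ([Balaban1985UV3] (7), nobody's), the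
K-FREE letter ⟨HAAR-TUBE₁⟩ in the `univ` currency and WITHOUT margin: for every radius `r > 0` and every MEASURABLE section `σ` of the one-step descent over the
interior window with `PlaqSmall θ_{J+1}(b₀) (σ U)`, ONE `q′ > 0` with `q′·dU_{J+1}(D⁻¹B) ≤ dU_{J+1}(D⁻¹B ∩ T_σ)` for all measurable `B ⊆ W_J(c·b₀)`.  px20 g11's
✓`…HaarTubeLocalCharge.haarTubeRel_depthOne` proves the `histGood(θ(b₀))`-RELATIVE letter for sections WITH margin `θ_{J+1}(c·b₀) − 4r`; at the edge of the full
window `θ_{J+1}(b₀)` no margin is available inside `histGood(θ(b₀))`.  THE REMEDY (this file): read px20's chart-with-local-charge ✓`exists_windowChart_localCharge` at the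
DOUBLED profile `2b₀` — `Sfine′ = histGood(θBal (2b₀)) (J+1) J`, `O′ = {PlaqSmall θ_J(2b₀)}`, valid for `γ ≤ γ₁(2b₀)` (legal: `γ₁` is chosen after `b₀`) — so that a
TUBE∘-admissible value `σ U` (`plaq < θ_{J+1}(b₀) = ½·θ_{J+1}(2b₀)`, lit ✓`θBal_mul`) sits with margin inside `Sfine′`; px20's §3 argument then runs verbatim on the compact
pair set `(D, id)″({plaq ≤ θ_{J+1}(b₀)} ∩ D⁻¹{plaq ≤ θ_J(c·b₀)})` through w4's ✓`hfib_of_pos` and px8 g14's ✓`haarTube_oneStep_of_windowChart`, giving the `Sfine′`-relative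
letter; px20's ✓`haarFloor_histGood_depthOne` at `(b₀, c) := (2b₀, c∕2)` (window `W_J((c∕2)·(2b₀)) = W_J(c·b₀)`) and ✓`haarTube_of_relative_and_floor` remove `Sfine′`.
* §1 ★★★ `haarTube_noMargin_depthOne` — the ⟨HAAR-TUBE₁⟩ conjunct of ✓`sectionTubeMassIntCan_of_up_low_haarTube`, as a theorem (shared prefix, `c₀ = 1`, `pS = 0`).
* §2 ★★★ `sectionTubeMassIntCan_of_up_low` — **TUBE∘ `SectionTubeMassIntCan` VERBATIM ⟸ ⟨UP⟩ + ⟨LOW(2θ)⟩ ONLY** (✓`…SectionTubeSplit` ll.226–233 bundle without its third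
  conjunct; prefix merge `c₀ := min`, `pS := max`, `γ₁ := min`).
So the K-free side of TUBE∘ is CLOSED, symmetric with the σ-free PERS₁∘ road (px8 g14 `…PersistenceKFree`); what TUBE∘ still owes is exactly Bałaban's K-uniform two-sided
density bounds of the run-`K` law of level `J+1` ([Balaban1985UV3] (5)–(7) read heightwise; LEAD's `…PersistenceFromHeightwiseBounds` names them against lit
`T3HeightwiseDensityBounds`).

HONEST SCOPE.  Measure∕topology bookkeeping over landed objects (px20's chart with local charge, w4's l.s.c.-floor engine, px8's door, px20's depth-one Haar floor,
LEAD's split); nothing of Bałaban's asserted; ⟨UP⟩, ⟨LOW⟩, TUBE∘ (as a whole), FH∘, PERS₁∘, PLAQTAIL∘, LFR♯ᶜ∘, S2β, the crux 20520 and every rung statement are NOT proved;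
`YM3TorusSU2` NOT proved; the Yang–Mills mass gap (Clay) NOT proved.

References: T. Bałaban, Commun. Math. Phys. **98** (1985) 17–51 [Balaban1985Averaging] ((10) p. 19, Prop. 1 p. 22); CMP **102** (1985) 255–275 [Balaban1985UV3]
((5)–(7) pp. 256–257, (38)–(40) p. 266); CMP **109** (1987) 249–301 [Balaban1987RG1] ((0.4) p. 253, (2.10) p. 267).
-/

set_option autoImplicit false

noncomputable section

open MeasureTheory Filter Topology Set Function
open scoped ENNReal NNReal
open Literature.MathematicalPhysics.QuantumFieldTheory.Balaban1983to89
open Literature.MathematicalPhysics.QuantumFieldTheory.Balaban1983to89.T3ContinuumYM3Torus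
open Literature.MathematicalPhysics.QuantumFieldTheory.Balaban1983to89.T3NestedUnitLaws
open Literature.MathematicalPhysics.QuantumFieldTheory.Balaban1983to89.T3UnitLawDensityEML
open Literature.MathematicalPhysics.QuantumFieldTheory.Balaban1983to89.T3UnitScaleTilt
open Literature.MathematicalPhysics.QuantumFieldTheory.Balaban1983to89.T3TiltDescent
open Literature.MathematicalPhysics.QuantumFieldTheory.Balaban1983to89.T3LevelShift
open Literature.MathematicalPhysics.QuantumFieldTheory.Balaban1983to89.T3Thresholds
open Literature.MathematicalPhysics.QuantumFieldTheory.Balaban1983to89.T3InteriorExcision (θBal_mul)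
open scoped Literature.MathematicalPhysics.QuantumFieldTheory.Balaban1983to89.T3OrbitAverage
open Summit.QuantumFields.YangMills.Theorems.FluctuationComparisonRegPrIntLWregGlue (WindowChart)
open Summit.QuantumFields.YangMills.Theorems.FluctuationComparisonRegPrIntLWregInterior (isOpen_histGood)
open Summit.QuantumFields.YangMills.Theorems.FluctuationComparisonRegPrIntLWregAssembly (exists_gamma_levelRegime isOpen_setOf_plaqSmall₂)
open Summit.QuantumFields.YangMills.Theorems.FluctuationComparisonRegPrIntLHaarTubeLscFloor (isOpen_linkTube measurable_tubeIntegrand hfib_of_pos)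
open Summit.QuantumFields.YangMills.Theorems.FluctuationComparisonRegPrIntLHaarTubeOneStep (haarTube_oneStep_of_windowChart)
open Summit.QuantumFields.YangMills.Theorems.FluctuationComparisonRegPrIntLHaarTubeLocalCharge (exists_windowChart_localCharge mem_histGood_succ_of lintegral_indicator_mul_pos)
open Summit.QuantumFields.YangMills.Theorems.FluctuationComparisonRegPrIntLHaarFloorDepthOne (haarFloor_histGood_depthOne haarTube_of_relative_and_floor)
open Summit.QuantumFields.YangMills.Theorems.FluctuationComparisonRegPrIntLSectionTubeSplit (sectionTubeMassIntCan_of_up_low_haarTube)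

namespace Summit.QuantumFields.YangMills.Theorems.FluctuationComparisonRegPrIntLHaarTubeNoMargin

variable (F : T3Family)

/-! ## §1 ⟨HAAR-TUBE₁⟩ without margin, via the charts at the doubled profile `2b₀` -/

/-- **The `Sfine′`-RELATIVE letter at the doubled profile** (px20 g11's §3 argument, re-run with the chart of ✓`exists_windowChart_localCharge` at `2b₀`): for fixed
`L, c ≤ 1, b₀, p₀ > 0` there is `γ₁ ∈ (0,1]` such that for `F.L = L`, `0 < γ ≤ γ₁`, every `J`, `r > 0` and every section `σ` (ANY function) with `D (σ U) = U` and
`PlaqSmall θ_{J+1}(b₀) (σ U)` on `W_J(c·b₀)`: ONE `q₁ > 0` with `q₁·dU_{J+1}(D⁻¹B ∩ histGood(θBal (2b₀)) (J+1) J) ≤ dU_{J+1}(D⁻¹B ∩ histGood(θBal (2b₀)) (J+1) J ∩ T_σ)` for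
all measurable `B ⊆ W_J(c·b₀)` — the value `σ U` has the margin `θ_{J+1}(b₀) = ½θ_{J+1}(2b₀)` inside the doubled fine set for free.
[cite: Balaban1985Averaging, (10) p.19 and Prop. 1 p.22; Balaban1987RG1, (0.4) p.253 and (2.10) p.267] -/
theorem haarTubeRel_doubled (L : ℕ) {c : ℝ} (hc1 : c ≤ 1) (b₀ p₀ : ℝ) (hb₀ : 0 < b₀) (hp₀ : 0 < p₀) :
    ∃ γ₁ : ℝ, 0 < γ₁ ∧ γ₁ ≤ 1 ∧ ∀ (F : T3Family) (γ : ℝ), F.L = L → 0 < γ → γ ≤ γ₁ →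
      ∀ (J : ℕ) (r : ℝ), 0 < r →
        ∀ σ : GaugeField (F.P J) 0 (Matrix.specialUnitaryGroup (Fin 2) ℂ) → GaugeField (F.P (J + 1)) 0 (Matrix.specialUnitaryGroup (Fin 2) ℂ),
          (∀ U : GaugeField (F.P J) 0 (Matrix.specialUnitaryGroup (Fin 2) ℂ), PlaqSmall (θBal F.L γ (c * b₀) p₀ J) U →
            descendTo F ℰp J (J + 1) (Nat.le_succ J) (σ U) = U ∧ PlaqSmall (θBal F.L γ b₀ p₀ (J + 1)) (σ U)) →
          ∃ q₁ : ℝ, 0 < q₁ ∧ ∀ (B : Set (GaugeField (F.P J) 0 (Matrix.specialUnitaryGroup (Fin 2) ℂ))), MeasurableSet B →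
            B ⊆ {U | PlaqSmall (θBal F.L γ (c * b₀) p₀ J) U} →
            ENNReal.ofReal q₁ * fieldMeasure (F.P (J + 1)) 0 (Matrix.specialUnitaryGroup (Fin 2) ℂ)
                (descendTo F ℰp J (J + 1) (Nat.le_succ J) ⁻¹' B ∩ histGood F ℰp (θBal F.L γ (2 * b₀) p₀) (J + 1) J) ≤
              fieldMeasure (F.P (J + 1)) 0 (Matrix.specialUnitaryGroup (Fin 2) ℂ)
                (descendTo F ℰp J (J + 1) (Nat.le_succ J) ⁻¹' B ∩ histGood F ℰp (θBal F.L γ (2 * b₀) p₀) (J + 1) J ∩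
                  {V | ∀ b : PBond (F.P (J + 1)) 0, dist1 ((σ (descendTo F ℰp J (J + 1) (Nat.le_succ J) V) b)⁻¹ * V b) < r}) := by
  have h2b₀ : 0 < 2 * b₀ := by positivity
  obtain ⟨γA, hγA, hγA1, hA⟩ := exists_windowChart_localCharge L (2 * b₀) p₀ h2b₀ hp₀
  obtain ⟨δ', γB, hδ', hγB, hB⟩ := exists_gamma_levelRegime L (2 * b₀) p₀ h2b₀ hp₀
  refine ⟨min γA γB, lt_min hγA hγB, (min_le_left _ _).trans hγA1, fun F γ hFL hγ hγle J r hr σ hσ => ?_⟩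
  have hγA' : γ ≤ γA := hγle.trans (min_le_left _ _)
  have hγB' : γ ≤ γB := hγle.trans (min_le_right _ _)
  have hLF : 1 ≤ F.L := F.hL.2.le
  have hγ1 : γ ≤ 1 := hγA'.trans hγA1
  obtain ⟨hsmall, hθlt⟩ := hB F γ hFL hγ hγB' (J + 1)
  -- the doubled profile and its window functions
  set θ := θBal F.L γ (2 * b₀) p₀ with hθdef
  have hθb : ∀ i, θBal F.L γ b₀ p₀ i = (1 / 2 : ℝ) * θ i := fun i => by
    rw [hθdef, θBal_mul]; ring
  have hθcb : ∀ i, θBal F.L γ (c * b₀) p₀ i = (c / 2) * θ i := fun i => by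
    rw [hθdef, θBal_mul, θBal_mul]; ring
  have hθpos : ∀ i, 0 < θ i := fun i => T3MinimiserStabilityReduction.θBal_pos hLF hγ hγ1 h2b₀ p₀ i
  have hθb_lt : ∀ i, θBal F.L γ b₀ p₀ i < θ i := fun i => by
    rw [hθb i]; exact mul_lt_of_lt_one_left (hθpos i) (by norm_num)
  have hθc_lt : ∀ i, θBal F.L γ (c * b₀) p₀ i < θ i := fun i => by
    rw [hθcb i]; exact mul_lt_of_lt_one_left (hθpos i) (by linarith)
  set Sfine := histGood F ℰp θ (J + 1) J with hSdef
  set O : Set (GaugeField (F.P J) 0 (Matrix.specialUnitaryGroup (Fin 2) ℂ)) := {V | PlaqSmall (θ J) V} with hOdef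
  have hO : IsOpen O := isOpen_setOf_plaqSmall₂ (F.P J) 0 (θ J)
  have hSm : MeasurableSet Sfine := measurableSet_histGood F ℰp measurableE_ℰp θ (J + 1) J
  have hSo : IsOpen Sfine := isOpen_histGood F hδ'.le (fun i => (hθlt i).le) hsmall (Nat.le_succ J)
  set W : Set (GaugeField (F.P J) 0 (Matrix.specialUnitaryGroup (Fin 2) ℂ)) := {U | PlaqSmall (θBal F.L γ (c * b₀) p₀ J) U} with hWdef
  have hWO : W ⊆ O := fun U hU p => (hU p).trans (hθc_lt J)
  obtain ⟨ch, hloc⟩ := hA F γ hFL hγ hγA' J (J + 1) (Nat.le_succ J)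
  -- continuity of the one-step descent on the small class
  have hs := F.sitesPerDir_eq (m := F.m) (K := J) (j := 0) (m' := F.m) (K' := J + 1) (j' := J + 1 - J) (by omega)
  have hDcont : ContinuousOn (descendTo F ℰp J (J + 1) (Nat.le_succ J))
      {x : GaugeField (F.P (J + 1)) 0 (Matrix.specialUnitaryGroup (Fin 2) ℂ) | PlaqSmall δ' x} := by
    have hfs : Continuous (fieldShift (G := Matrix.specialUnitaryGroup (Fin 2) ℂ) hs) := continuous_pi fun _ => continuous_apply _
    have havg := Summit.QuantumFields.YangMills.Theorems.FibrePositivity.continuousOn_blockAvg_expMeanLogSU (P := F.P (J + 1)) (j := 0) (n := Fin 2)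
      hδ'.le hsmall
    have hiter : ContinuousOn (Averaging.iter (fun i => BlockAveraging.blockAvg (P := F.P (J + 1)) (j := i) ℰp) (J + 1 - J))
        {x : GaugeField (F.P (J + 1)) 0 (Matrix.specialUnitaryGroup (Fin 2) ℂ) | PlaqSmall δ' x} := by
      rw [Nat.add_sub_cancel_left]
      exact havg
    exact hfs.comp_continuousOn hiter
  -- the compact admissible pair set: fine plaquettes ≤ θ_{J+1}(b₀) (NO margin needed), datum plaquettes ≤ θ_J(c b₀)
  set C₁ : Set (GaugeField (F.P (J + 1)) 0 (Matrix.specialUnitaryGroup (Fin 2) ℂ)) :=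
    {x | ∀ p, dist1 (GaugeField.plaqHol x p) ≤ θBal F.L γ b₀ p₀ (J + 1)} with hC₁def
  set C₂ : Set (GaugeField (F.P J) 0 (Matrix.specialUnitaryGroup (Fin 2) ℂ)) := {V | ∀ p, dist1 (GaugeField.plaqHol V p) ≤ θBal F.L γ (c * b₀) p₀ J} with hC₂def
  have hC₁δ : C₁ ⊆ {x | PlaqSmall δ' x} := fun x hx p => (hx p).trans_lt ((hθb_lt (J + 1)).trans (hθlt (J + 1)))
  have hDC : ContinuousOn (descendTo F ℰp J (J + 1) (Nat.le_succ J)) C₁ := hDcont.mono hC₁δ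
  have hCcpt : IsCompact (C₁ ∩ descendTo F ℰp J (J + 1) (Nat.le_succ J) ⁻¹' C₂) :=
    (hDC.preimage_isClosed_of_isClosed (Summit.QuantumFields.YangMills.BalabanUVNodes.N07DirectMethod.isClosed_plaqLe (N := 2) _)
      (Summit.QuantumFields.YangMills.BalabanUVNodes.N07DirectMethod.isClosed_plaqLe (N := 2) _)).isCompact
  set P : Set (GaugeField (F.P J) 0 (Matrix.specialUnitaryGroup (Fin 2) ℂ) × GaugeField (F.P (J + 1)) 0 (Matrix.specialUnitaryGroup (Fin 2) ℂ)) :=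
    (fun x => (descendTo F ℰp J (J + 1) (Nat.le_succ J) x, x)) '' (C₁ ∩ descendTo F ℰp J (J + 1) (Nat.le_succ J) ⁻¹' C₂) with hPdef
  have hP : IsCompact P := hCcpt.image_of_continuousOn ((hDC.mono Set.inter_subset_left).prodMk continuousOn_id)
  have hPO : P ⊆ O ×ˢ Set.univ := by
    rintro _ ⟨x, hx, rfl⟩
    exact ⟨fun p => (hx.2 p).trans_lt (hθc_lt J), Set.mem_univ _⟩
  have hpos : ∀ p ∈ P, 0 < ∫⁻ z, (Sfine ∩ {V : GaugeField (F.P (J + 1)) 0 (Matrix.specialUnitaryGroup (Fin 2) ℂ) |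
      ∀ b : PBond (F.P (J + 1)) 0, dist1 ((p.2 b)⁻¹ * V b) < r}).indicator (fun _ => (1 : ℝ≥0∞)) (ch.Φ (p.1, z)) * (ch.jac (p.1, z) : ℝ≥0∞)
        ∂(fieldMeasure (F.P (J + 1)) 0 (Matrix.specialUnitaryGroup (Fin 2) ℂ)) := by
    rintro _ ⟨x, hx, rfl⟩
    dsimp only
    have hxtop : PlaqSmall (θ (J + 1)) x := fun p => (hx.1 p).trans_lt (hθb_lt (J + 1))
    have hxbase : PlaqSmall (θ J) (descendTo F ℰp J (J + 1) (Nat.le_succ J) x) := fun p => (hx.2 p).trans_lt (hθc_lt J)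
    have hxS : x ∈ Sfine := mem_histGood_succ_of F θ hxtop hxbase
    have hxT : x ∈ {V : GaugeField (F.P (J + 1)) 0 (Matrix.specialUnitaryGroup (Fin 2) ℂ) | ∀ b : PBond (F.P (J + 1)) 0, dist1 ((x b)⁻¹ * V b) < r} := by
      intro b
      rw [inv_mul_cancel, GaugeGroup.dist1_one]
      exact hr
    have hN : Sfine ∩ {V : GaugeField (F.P (J + 1)) 0 (Matrix.specialUnitaryGroup (Fin 2) ℂ) | ∀ b : PBond (F.P (J + 1)) 0, dist1 ((x b)⁻¹ * V b) < r} ∈ 𝓝 x :=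
      (hSo.inter (isOpen_linkTube x r)).mem_nhds ⟨hxS, hxT⟩
    have hlocx : 0 < fieldMeasure (F.P (J + 1)) 0 (Matrix.specialUnitaryGroup (Fin 2) ℂ)
        {z | ch.jac (descendTo F ℰp J (J + 1) (Nat.le_succ J) x, z) ≠ 0 ∧ ch.Φ (descendTo F ℰp J (J + 1) (Nat.le_succ J) x, z) ∈
          Sfine ∩ {V : GaugeField (F.P (J + 1)) 0 (Matrix.specialUnitaryGroup (Fin 2) ℂ) | ∀ b : PBond (F.P (J + 1)) 0, dist1 ((x b)⁻¹ * V b) < r}} :=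
      hloc _ hxbase x rfl hxS _ hN Set.inter_subset_left
    exact lintegral_indicator_mul_pos (Φ := fun z => ch.Φ (descendTo F ℰp J (J + 1) (Nat.le_succ J) x, z))
      (jac := fun z => ch.jac (descendTo F ℰp J (J + 1) (Nat.le_succ J) x, z)) _
      (measurable_tubeIntegrand F (Nat.le_succ J) ch hSm r (descendTo F ℰp J (J + 1) (Nat.le_succ J) x, x)) hlocx
  have hσP : ∀ U ∈ O ∩ W, (U, σ U) ∈ P := by
    intro U hU
    obtain ⟨hDσ, hσsmall⟩ := hσ U hU.2
    refine ⟨σ U, ⟨fun p => (hσsmall p).le, ?_⟩, ?_⟩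
    · show ∀ p, dist1 (GaugeField.plaqHol (descendTo F ℰp J (J + 1) (Nat.le_succ J) (σ U)) p) ≤ θBal F.L γ (c * b₀) p₀ J
      rw [hDσ]
      exact fun p => (hU.2 p).le
    · show (descendTo F ℰp J (J + 1) (Nat.le_succ J) (σ U), σ U) = (U, σ U)
      rw [hDσ]
  obtain ⟨q, hq, hfib⟩ := hfib_of_pos F (Nat.le_succ J) ch hSm r hP hPO hpos σ W hσP
  refine ⟨q, hq, fun B hB hBW => ?_⟩
  exact haarTube_oneStep_of_windowChart F ch hO hSm σ r W hfib B hB (fun U hUB => ⟨hWO (hBW hUB), hBW hUB⟩)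

/-- ★★★ **⟨HAAR-TUBE₁⟩ WITHOUT MARGIN, UNCONDITIONALLY** — the third conjunct of ✓`…SectionTubeSplit.sectionTubeMassIntCan_of_up_low_haarTube`, in the shared prefix
(`c₀ = 1`, `pS = 0`): for every radius `r > 0` and every MEASURABLE section `σ` of the one-step descent over the interior window `W_J(c·b₀)` with values in the
FULL level-`(J+1)` window (`PlaqSmall θ_{J+1}(b₀) (σ U)`), ONE `q′ > 0` (after `F, γ, J, c, r`; before `σ`'s use and `B`) gives
`ofReal q′ · dU_{J+1}(D⁻¹B) ≤ dU_{J+1}(D⁻¹B ∩ {V | ∀ b, dist1 ((σ (D V) b)⁻¹ · V b) < r})` for every measurable `B ⊆ W_J(c·b₀)` — §1's relative letter at the doubled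
profile times px20 g11's depth-one Haar floor ✓`haarFloor_histGood_depthOne` read at `(2b₀, c∕2)`, glued by ✓`haarTube_of_relative_and_floor`.
[cite: Balaban1985Averaging, (10) p.19 and Prop. 1 p.22; Balaban1985UV3, (7) p.257 and (38)-(40) p.266; Balaban1987RG1, (0.4) p.253 and (2.10) p.267] -/
theorem haarTube_noMargin_depthOne :
    ∀ (L : ℕ), ∃ c₀ : ℝ, 0 < c₀ ∧ c₀ ≤ 1 ∧ ∀ (c : ℝ), 0 < c → c ≤ c₀ → ∃ pS : ℝ, ∀ (b₀ p₀ : ℝ), 0 < b₀ → pS ≤ p₀ → 0 < p₀ →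
      ∃ γ₁ : ℝ, 0 < γ₁ ∧ γ₁ ≤ 1 ∧ ∀ (F : T3Family) (γ : ℝ), F.L = L → 0 < γ → γ ≤ γ₁ →
        ∀ (J : ℕ) (r : ℝ), 0 < r →
          ∀ σ : GaugeField (F.P J) 0 (Matrix.specialUnitaryGroup (Fin 2) ℂ) → GaugeField (F.P (J + 1)) 0 (Matrix.specialUnitaryGroup (Fin 2) ℂ), Measurable σ →
            (∀ U : GaugeField (F.P J) 0 (Matrix.specialUnitaryGroup (Fin 2) ℂ), PlaqSmall (θBal F.L γ (c * b₀) p₀ J) U →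
              descendTo F ℰp J (J + 1) (Nat.le_succ J) (σ U) = U ∧ PlaqSmall (θBal F.L γ b₀ p₀ (J + 1)) (σ U)) →
            ∃ q' : ℝ, 0 < q' ∧ ∀ (B : Set (GaugeField (F.P J) 0 (Matrix.specialUnitaryGroup (Fin 2) ℂ))), MeasurableSet B →
              B ⊆ {U | PlaqSmall (θBal F.L γ (c * b₀) p₀ J) U} →
              ENNReal.ofReal q' * fieldMeasure (F.P (J + 1)) 0 (Matrix.specialUnitaryGroup (Fin 2) ℂ) (descendTo F ℰp J (J + 1) (Nat.le_succ J) ⁻¹' B) ≤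
                fieldMeasure (F.P (J + 1)) 0 (Matrix.specialUnitaryGroup (Fin 2) ℂ) (descendTo F ℰp J (J + 1) (Nat.le_succ J) ⁻¹' B ∩
                  {V | ∀ b : PBond (F.P (J + 1)) 0, dist1 ((σ (descendTo F ℰp J (J + 1) (Nat.le_succ J) V) b)⁻¹ * V b) < r}) := by
  intro L
  refine ⟨1, one_pos, le_rfl, fun c hc hc1 => ⟨0, fun b₀ p₀ hb₀ _ hp₀ => ?_⟩⟩
  have h2b₀ : 0 < 2 * b₀ := by positivity
  obtain ⟨γR, hγR, hγR1, hR⟩ := haarTubeRel_doubled L hc1 b₀ p₀ hb₀ hp₀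
  obtain ⟨γE, hγE, hE⟩ := haarFloor_histGood_depthOne L (2 * b₀) p₀ h2b₀ hp₀
  refine ⟨min γR γE, lt_min hγR hγE, (min_le_left _ _).trans hγR1, fun F γ hFL hγ hγle J r hr σ _ hσ => ?_⟩
  obtain ⟨q₁, hq₁, hrel⟩ := hR F γ hFL hγ (hγle.trans (min_le_left _ _)) J r hr σ hσ
  obtain ⟨q₂, hq₂, hfloor⟩ := hE F γ hFL hγ (hγle.trans (min_le_right _ _)) J (c / 2) (by positivity) (by linarith)
  have hwin : (c / 2) * (2 * b₀) = c * b₀ := by ring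
  rw [hwin] at hfloor
  refine ⟨q₁ * q₂, mul_pos hq₁ hq₂, fun B hB hBW => ?_⟩
  exact haarTube_of_relative_and_floor _ hq₁.le (hrel B hB hBW) (hfloor B hB hBW)

/-! ## §2 TUBE∘ ⟸ ⟨UP⟩ + ⟨LOW(2θ)⟩ only -/

/-- ★★★ **TUBE∘ `SectionTubeMassIntCan` VERBATIM FROM THE TWO K-UNIFORM LETTERS ALONE**: ⟨UP⟩ (the run-`K` law of level `J+1` is dominated by product Haar over the
interior window, constant after `F, γ, J`) and ⟨LOW(2θ)⟩ (it dominates a multiple of product Haar on `{PlaqSmall 2θ_{J+1}(b₀)}`) — EXACTLY the first two conjuncts of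
✓`…SectionTubeSplit.sectionTubeMassIntCan_of_up_low_haarTube` ll.226–233 — imply TUBE∘ (`Lines/persistence_geometry.lean` row, text verbatim): the third conjunct
⟨HAAR-TUBE₁⟩ is now §1's theorem (prefix merge `c₀ := min`, `pS := max`, `γ₁ := min`).  ⟨UP⟩∕⟨LOW⟩ = [Balaban1985UV3] (5)–(7) read heightwise — DISPLAYED, nobody's
tonight, NOT proved here. [cite: Balaban1985UV3, (5)-(7) pp.256-257 and (38)-(40) p.266; Balaban1985Averaging, Prop. 1 p.22; Balaban1987RG1, (0.18)-(0.22) p.255] -/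
theorem sectionTubeMassIntCan_of_up_low
    (hUL : ∀ (L : ℕ), ∃ c₀ : ℝ, 0 < c₀ ∧ c₀ ≤ 1 ∧ ∀ (c : ℝ), 0 < c → c ≤ c₀ → ∃ pS : ℝ, ∀ (b₀ p₀ : ℝ), 0 < b₀ → pS ≤ p₀ → 0 < p₀ →
      ∃ γ₁ : ℝ, 0 < γ₁ ∧ γ₁ ≤ 1 ∧ ∀ (F : T3Family) (γ : ℝ), F.L = L → 0 < γ → γ ≤ γ₁ →
        ∀ (J : ℕ),
          ∃ C cl : ℝ, 0 < C ∧ 0 < cl ∧ ∀ (K : ℕ) (hJK : J + 1 ≤ K),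
            ((gibbsK F ℰp γ K).map (descendTo F ℰp (J + 1) K hJK)).restrict
                (descendTo F ℰp J (J + 1) (Nat.le_succ J) ⁻¹' {U | PlaqSmall (θBal F.L γ (c * b₀) p₀ J) U}) ≤
              ENNReal.ofReal C • (fieldMeasure (F.P (J + 1)) 0 (Matrix.specialUnitaryGroup (Fin 2) ℂ)).restrict
                (descendTo F ℰp J (J + 1) (Nat.le_succ J) ⁻¹' {U | PlaqSmall (θBal F.L γ (c * b₀) p₀ J) U}) ∧
            ENNReal.ofReal cl • (fieldMeasure (F.P (J + 1)) 0 (Matrix.specialUnitaryGroup (Fin 2) ℂ)).restrict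
                {V | PlaqSmall (2 * θBal F.L γ b₀ p₀ (J + 1)) V} ≤
              ((gibbsK F ℰp γ K).map (descendTo F ℰp (J + 1) K hJK)).restrict {V | PlaqSmall (2 * θBal F.L γ b₀ p₀ (J + 1)) V}) :
    ∀ (L : ℕ), ∃ c₀ : ℝ, 0 < c₀ ∧ c₀ ≤ 1 ∧ ∀ (c : ℝ), 0 < c → c ≤ c₀ → ∃ pS : ℝ, ∀ (b₀ p₀ : ℝ), 0 < b₀ → pS ≤ p₀ → 0 < p₀ →
      ∃ γ₁ : ℝ, 0 < γ₁ ∧ ∀ (F : T3Family) (γ : ℝ), F.L = L → 0 < γ → γ ≤ γ₁ →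
        ∀ (J : ℕ) (r : ℝ), 0 < r →
          ∀ σ : GaugeField (F.P J) 0 (Matrix.specialUnitaryGroup (Fin 2) ℂ) → GaugeField (F.P (J + 1)) 0 (Matrix.specialUnitaryGroup (Fin 2) ℂ), Measurable σ →
            (∀ U : GaugeField (F.P J) 0 (Matrix.specialUnitaryGroup (Fin 2) ℂ), PlaqSmall (θBal F.L γ (c * b₀) p₀ J) U →
              descendTo F ℰp J (J + 1) (Nat.le_succ J) (σ U) = U ∧ PlaqSmall (θBal F.L γ b₀ p₀ (J + 1)) (σ U)) →
            ∃ q : ℝ, 0 < q ∧ ∀ (K : ℕ) (hJK : J + 1 ≤ K)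
              (B : Set (GaugeField (F.P J) 0 (Matrix.specialUnitaryGroup (Fin 2) ℂ))), MeasurableSet B →
                B ⊆ {U | PlaqSmall (θBal F.L γ (c * b₀) p₀ J) U} →
                ENNReal.ofReal q * gibbsK F ℰp γ K (descendTo F ℰp J K ((Nat.le_succ J).trans hJK) ⁻¹' B) ≤
                  gibbsK F ℰp γ K (descendTo F ℰp J K ((Nat.le_succ J).trans hJK) ⁻¹' B ∩
                    {V | ∀ b : PBond (F.P (J + 1)) 0,
                      dist1 ((σ (descendTo F ℰp J K ((Nat.le_succ J).trans hJK) V) b)⁻¹ *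
                        descendTo F ℰp (J + 1) K hJK V b) < r}) := by
  refine sectionTubeMassIntCan_of_up_low_haarTube fun L => ?_
  obtain ⟨c₀U, hc₀U, hc₀U1, hU⟩ := hUL L
  obtain ⟨c₀H, hc₀H, _, hH⟩ := haarTube_noMargin_depthOne L
  refine ⟨min c₀U c₀H, lt_min hc₀U hc₀H, (min_le_left _ _).trans hc₀U1, fun c hc hcle => ?_⟩
  obtain ⟨pSU, hpSU⟩ := hU c hc (hcle.trans (min_le_left _ _))
  obtain ⟨pSH, hpSH⟩ := hH c hc (hcle.trans (min_le_right _ _))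
  refine ⟨max pSU pSH, fun b₀ p₀ hb₀ hpS hp₀ => ?_⟩
  obtain ⟨γU, hγU, hγU1, hFU⟩ := hpSU b₀ p₀ hb₀ ((le_max_left _ _).trans hpS) hp₀
  obtain ⟨γH, hγH, _, hFH⟩ := hpSH b₀ p₀ hb₀ ((le_max_right _ _).trans hpS) hp₀
  refine ⟨min γU γH, lt_min hγU hγH, (min_le_left _ _).trans hγU1, fun F γ hFL hγ hγle J => ⟨?_, ?_⟩⟩
  · exact hFU F γ hFL hγ (hγle.trans (min_le_left _ _)) J
  · exact fun r hr σ hσm hσ => hFH F γ hFL hγ (hγle.trans (min_le_right _ _)) J r hr σ hσm hσ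

end Summit.QuantumFields.YangMills.Theorems.FluctuationComparisonRegPrIntLHaarTubeNoMargin

end
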